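import Summits.QuantumFields.BalabanUV.Beta.D1BFx.MomentTransferPeriodicEntry
import Summits.QuantumFields.BalabanUV.Beta.D1BFx.RoadEnd

/-!
# `BalabanUV.Beta.D1BFx.Assembly` — road «BF-x» for binder row D1, leaf A7 (skeleton-in-Lean): THE ROAD'S TARGET T FROM ITS NAMED SLOTS
# (K) kernel-level slice transfer + reduction · (U) unit pieces · (F) fine representation per piece · (SPLIT) term list with MAIN isolated · (REST)
# n-uniform bounds — and the JUNCTION between the tree's two fine currencies (`avgM2`/`baseKer` of K-R5 ↔ `Σ_b wt·fullSum` of an3's END)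

HONEST DEPENDENCY (page 1, mandatory): continuum YM on T⁴ ⇐ BetaPertH ∧ nine spine estimates (0/9 proved); BetaPertH ⇐ (D1) ∧ (D4) ∧
CAP+tail; G-an2-4 gates asym, D1 and NE2/3/4.  HONEST FRAMING (cell contract, verbatim): «discharging `BetaPertH` makes Bałaban's UV
stability UNCONDITIONAL — a real constructive-QFT result; it is NOT the continuum limit and NOT the Clay problem.»  THIS MODULE DISCHARGES
NOTHING of the wall: it is [folklore] bookkeeping (finite sums, `fullSum` linearity on convergent pieces, one `tsum` ↔ `fullSum` junction)
that turns the remaining OPEN leaves of road «BF-x» into TYPED SLOTS of one theorem whose conclusion is LITERALLY the binder `hT` of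
`RoadEnd.d1Drift_of_strongRoad` / `ShellRoadEnd.d1Drift_of_strongRoad_shell` (strong grading) resp. of `RoadEnd.d1Drift_of_meanRoad_table`
(mean grading).  Every slot is a HYPOTHESIS; no `def`, no `Prop` is minted, nothing printed is asserted, 0 sorry.  0 wall binders instantiated;
NOT D1, NOT `BetaPertH`, NOT continuum, NOT Clay.

ABSOLUTE RULE (cell charter, verbatim): «No internally-minted statement may enter as a cited fact. Every hypothesis is either kernel-proved in
this package or a verbatim quotation of a PUBLISHED theorem with page reference. The manuscript(s) under audit are NOT citable for their own
disputed steps — they are the thing under adjudication; programme-internal (2001/route/tribunal) claims are never citable.»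

WHY (skeleton `HOME/beta/skeletons/D1-b2b-balaban-beta-d1-p2.md` v1.5 node A7 «ASSEMBLY ⇒ T»; OWNER-RULINGS-1 R-8 «A7-skeleton-in-Lean: T over the
landed pieces with K-R1, A0, A1.ii, A3.a/b, A5 as hypotheses BY NAME — makes the remaining obligations kernel-precise»).  The road's target is
T: `∀ m ≥ 1, |c (Lc^m) − Σ_{b ∈ Bset (Lc^m)} wt (Lc^m) b · fullSum (stK μ ν N (Gf (Lc^m) b))| ≤ U` with `c := FirstStepLargeBlock.shotCoeff …`
(the one-shot coefficient), `Gf` the scalar diagonal gluon leg at the base point, `stK` an3's realised background-field kernel.  The road computes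
`c n` in four moves, each an OPEN or LANDED leaf; THIS FILE says exactly what each must deliver, as the hypotheses of `defect_eq_of_slots`:
* (K)  [K-R1 kernel level ∘ K-R2 ∘ O1]  `c n = Σ_{i : ι} ω i n · secondMoment (P i n) μ ν + Σ_{u : υ} R u n` — the one-shot coefficient is a
  finite weighted sum of (1.22)-moments of ℋ-dressed FINE-LOOP one-shot kernels `P i n` (reduced gluon `GluonKernel.Pgl`, ghost
  `GhostKernelComplete.PghQ`, …; loop weights of record `K-R1-SPEC.md` §2: reduced +1 · scalar tower −2 · …, with their `n`-power
  normalisations, all inside `ω`) plus finitely many UNIT / COARSE-LOOP / TREE-LEVEL pieces `R u n` (Gram terms, axial ghost, resp × one-point;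
  A0-TERM-CENSUS rows «unit», «gh-gram», «gh-axial», «resp×1pt»);
* (U)  [A5.0/A5.1, A6]  `|R u n| ≤ CU u` for `n ≥ 2` (`UnitLoopCount` / `ContactCount` shape);
* (F)  [K-R5 = A4 chain, LANDED for the gluon and ghost pieces: `ReducedKernelSandwich(Leg).secondMoment_TOf{Red,Leg,Gh}_eq`]
  `secondMoment (P i n) μ ν = Σ_{b ∈ Bset n} wt n b · fullSum (Kf i n b)` — each fine-loop piece IS a base-point average of punctured full sums
  of an explicit fine integrand; §3 below DERIVES this shape (with `Bset n` = the residue sites `[0,n)⁴`, `wt n b = n⁻⁴`,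
  `Kf i n b w = n⁻⁸·w_μw_ν·baseKer (Q i n) b w`) from the tree's `secondMoment … = n⁻⁸ · avgM2 n (Q i n) μ ν` and the absolute second moments
  of the base-point kernels (`hF_of_avgM2`), so for the landed pieces (F) is ALREADY a theorem up to that junction;
* (SPLIT)  [A0 ∘ A1.ii — OPEN, the road's located content]  pointwise in the fine displacement `w` and the base point `b`:
  `Σ_i ω i n · Kf i n b w = stK μ ν N (Gf n b) w + Σ_{τ : T} Kr τ n b w` — the finite TERM LIST with the MAIN term isolated as an3's realised
  kernel over the scalar diagonal leg `Gf n b` (A1.ii) and every other term named (`T` finite: A0-TERM-CENSUS rows deg≥7, τ1…τ6, tad-blk,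
  gh-corr, RR-blk, dress);
* (REST)  [A2 `DegreeSevenCount`, A3.0 `ScaledWindowCount` + A3.a/A3.b/A3.c, A4 `CrossTermBounds`]  `|Σ_b wt n b · fullSum (Kr τ n b)| ≤ CR τ`;
* (CONV)  every piece has convergent punctured partial sums (from the `Decays`/`AbsMoment₂` facts each leaf proves anyway).
CONCLUSION (`defect_eq_of_slots`, an IDENTITY): `c n − Σ_b wt n b · fullSum (stK μ ν N (Gf n b)) = Σ_u R u n + Σ_τ Σ_b wt n b · fullSum (Kr τ n b)`
for every `n ≥ 2`; hence `abs_defect_le_of_slots` (`≤ Σ_u CU u + Σ_τ CR τ`), the STRONG target `hT_of_slots` along `n = Lc^m` (EXACTLY the `hT`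
binder of `RoadEnd.d1Drift_of_strongRoad` / `ShellRoadEnd.d1Drift_of_strongRoad_shell`, with `U := Σ_u CU u + Σ_τ CR τ`), and the MEAN target
`hT_mean_of_slots` (EXACTLY the `hT` binder of `RoadEnd.d1Drift_of_meanRoad_table`) when the (U)/(REST) bounds grow like `g m` with
`g m / m → 0` — the mean grading's «every O(1) may be replaced by o(log n)» made literal.
NO SLOT IS T IN DISGUISE when instantiated as scheduled: (K) and (F) are IDENTITIES between explicit tree objects, (SPLIT) is a pointwise
identity of explicit finite stencil tables, (U)/(REST) are n-uniform bounds on explicit NON-MAIN tables; the drift/slope `stepBal`/`kappaBal`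
appears nowhere (it is OUTPUT of an3's `hval_bf` inside the END).  [B12 p. 264 (1.22), pp. 290–291 (4.36)–(4.37), (5.1): CONTEXT for «sum
over localization domains, replace H_j(□₀) by H_j, extend the summations to Z⁴» — the printed shape of (F)+(SPLIT); nothing printed is asserted.]

CONTENT (all [folklore]).
* §1 `fullSum` over finite families of convergent pieces: `fullSum_zero'`, `exists_tendsto_psum_const_mul`, `exists_tendsto_psum_finset_sum`,
  `fullSum_finset_sum`, `fullSum_sub'`, `fullSum_weighted_combination` (`fullSum (Σ_i a_i K_i − Σ_τ K′_τ) = Σ_i a_i fullSum K_i − Σ_τ fullSum K′_τ`).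
* §2 THE JUNCTION `tsum` ↔ `fullSum` for the (1.22)-weighted base-point kernels: `summable_weight_mul_of_absMoment₂`,
  `fullSum_weight_mul_eq_tsum` (`fullSum (w ↦ w_κw_λ·f w) = Σ' t, t_κt_λ·f t` for `AbsMoment₂ f` — the origin has weight 0),
  **`avgM2_eq_sum_fullSum`** (`avgM2 n Q κ λ = Σ_{r : [0,n)⁴} n⁻⁴ · fullSum (w ↦ w_κw_λ·baseKer Q (resSite r) w)`), `resSite_injective`,
  `sum_image_resSite`, `card_image_resSite`, the uniform weights `sum_uniform_resSite` (= 1) — i.e. the `hwt0`/`hwt1` binders of the END for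
  this base-point family.
* §3 (F) FROM THE TREE'S K-R5 CURRENCY: **`hF_of_avgM2`**, `conv_of_avgM2` (the (CONV) slot for these pieces, from `AbsMoment₂`).
* §4 THE ASSEMBLY: **`defect_eq_of_slots`**, **`abs_defect_le_of_slots`**, **`hT_of_slots`** (strong), **`hT_mean_of_slots`** (mean).
Unit `b2b-balaban-beta-d1-p2` (road owner, gen 2); `LEAVES-BFx.md` row A7.
-/

open Finset Filter Topology
open scoped BigOperators
open Literature.MathematicalPhysics.QuantumFieldTheory.Balaban1983to89
open Literature.MathematicalPhysics.QuantumFieldTheory.Balaban1983to89.Beta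
open WindowIdentification (fullSum psum psum_add psum_const_mul fullSum_add fullSum_const_mul exists_tendsto_psum_add fullSum_eq_of_tendsto
  fullSum_eq_tsum_sub exists_tendsto_psum_of_summable)
open DyadicShell (Pt toReal toReal_apply)
open SquareTable (stK)
open DecimatedMomentSummable (AbsMoment₂ IsMoment₂ summable_smul_of_absMoment₂)
open DressedMomentNormalisation (resSite)
open Summit.QuantumFields.BalabanUV.Beta.D1BFx.MomentTransferPeriodic (Ker₂ baseKer)
open Summit.QuantumFields.BalabanUV.Beta.D1BFx.MomentTransferPeriodicEntry (avgM2)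

namespace Summit.QuantumFields.BalabanUV.Beta.D1BFx.Assembly

/-! ## §1 `fullSum` over finite families of convergent pieces -/

section FullSum

/-- [folklore] The punctured full sum of the zero kernel is `0`. -/
theorem fullSum_zero' : fullSum (fun _ : Pt => (0 : ℝ)) = 0 := by
  refine fullSum_eq_of_tendsto ?_
  have e : psum (fun _ : Pt => (0 : ℝ)) = fun _ => 0 := funext fun R => by simp [WindowIdentification.psum_def]
  rw [e]
  exact tendsto_const_nhds

/-- [folklore] Convergent partial sums are preserved by scalar multiplication. -/
theorem exists_tendsto_psum_const_mul (a : ℝ) {K : Pt → ℝ} (h : ∃ B, Tendsto (psum K) atTop (𝓝 B)) :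
    ∃ B, Tendsto (psum (fun w => a * K w)) atTop (𝓝 B) := by
  obtain ⟨B, hB⟩ := h
  refine ⟨a * B, ?_⟩
  have e : psum (fun w => a * K w) = fun R => a * psum K R := funext (psum_const_mul a K)
  rw [e]
  exact hB.const_mul a

/-- [folklore] Convergent partial sums are preserved by finite sums. -/
theorem exists_tendsto_psum_finset_sum {ι : Type*} (s : Finset ι) {K : ι → Pt → ℝ}
    (h : ∀ i ∈ s, ∃ B, Tendsto (psum (K i)) atTop (𝓝 B)) :
    ∃ B, Tendsto (psum (fun w => ∑ i ∈ s, K i w)) atTop (𝓝 B) := by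
  classical
  induction s using Finset.induction_on with
  | empty =>
    refine ⟨0, ?_⟩
    have e : psum (fun w : Pt => ∑ i ∈ (∅ : Finset ι), K i w) = fun _ => 0 := funext fun R => by
      simp [WindowIdentification.psum_def]
    rw [e]
    exact tendsto_const_nhds
  | insert a s ha ih =>
    have h' := exists_tendsto_psum_add (h a (mem_insert_self a s)) (ih fun i hi => h i (mem_insert_of_mem hi))
    have e : (fun w : Pt => ∑ i ∈ insert a s, K i w) = fun w => K a w + ∑ i ∈ s, K i w :=
      funext fun w => sum_insert ha
    rw [e]
    exact h'

/-- [folklore] **`fullSum` IS ADDITIVE OVER FINITE FAMILIES of kernels with convergent punctured partial sums.** -/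
theorem fullSum_finset_sum {ι : Type*} (s : Finset ι) {K : ι → Pt → ℝ}
    (h : ∀ i ∈ s, ∃ B, Tendsto (psum (K i)) atTop (𝓝 B)) :
    fullSum (fun w => ∑ i ∈ s, K i w) = ∑ i ∈ s, fullSum (K i) := by
  classical
  induction s using Finset.induction_on with
  | empty =>
    simp only [sum_empty]
    exact fullSum_zero'
  | insert a s ha ih =>
    have hs : ∀ i ∈ s, ∃ B, Tendsto (psum (K i)) atTop (𝓝 B) := fun i hi => h i (mem_insert_of_mem hi)
    have e : (fun w : Pt => ∑ i ∈ insert a s, K i w) = fun w => K a w + ∑ i ∈ s, K i w :=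
      funext fun w => sum_insert ha
    rw [e, fullSum_add (h a (mem_insert_self a s)) (exists_tendsto_psum_finset_sum s hs), ih hs, sum_insert ha]

/-- [folklore] `fullSum` of a weighted finite family: `fullSum (w ↦ Σ_i a_i·K_i w) = Σ_i a_i·fullSum K_i`. -/
theorem fullSum_finset_sum_const_mul {ι : Type*} (s : Finset ι) (a : ι → ℝ) {K : ι → Pt → ℝ}
    (h : ∀ i ∈ s, ∃ B, Tendsto (psum (K i)) atTop (𝓝 B)) :
    fullSum (fun w => ∑ i ∈ s, a i * K i w) = ∑ i ∈ s, a i * fullSum (K i) := by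
  rw [fullSum_finset_sum s (fun i hi => exists_tendsto_psum_const_mul (a i) (h i hi))]
  exact sum_congr rfl fun i hi => fullSum_const_mul (a i) (h i hi)

/-- [folklore] `fullSum` of a difference of convergent pieces. -/
theorem fullSum_sub' {K₁ K₂ : Pt → ℝ} (h₁ : ∃ B, Tendsto (psum K₁) atTop (𝓝 B)) (h₂ : ∃ B, Tendsto (psum K₂) atTop (𝓝 B)) :
    fullSum (fun w => K₁ w - K₂ w) = fullSum K₁ - fullSum K₂ := by
  have e : (fun w => K₁ w - K₂ w) = fun w => K₁ w + (-1) * K₂ w := funext fun w => by ring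
  rw [e, fullSum_add h₁ (exists_tendsto_psum_const_mul (-1) h₂), fullSum_const_mul (-1) h₂]
  ring

/-- [folklore] **THE WEIGHTED COMBINATION RULE**: `fullSum (w ↦ Σ_i a_i K_i w − Σ_τ K′_τ w) = Σ_i a_i·fullSum K_i − Σ_τ fullSum K′_τ` for
finite families of convergent pieces. -/
theorem fullSum_weighted_combination {ι T : Type*} (s : Finset ι) (t : Finset T) (a : ι → ℝ) {K : ι → Pt → ℝ} {K' : T → Pt → ℝ}
    (hK : ∀ i ∈ s, ∃ B, Tendsto (psum (K i)) atTop (𝓝 B)) (hK' : ∀ τ ∈ t, ∃ B, Tendsto (psum (K' τ)) atTop (𝓝 B)) :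
    fullSum (fun w => (∑ i ∈ s, a i * K i w) - ∑ τ ∈ t, K' τ w) = (∑ i ∈ s, a i * fullSum (K i)) - ∑ τ ∈ t, fullSum (K' τ) := by
  rw [fullSum_sub' (exists_tendsto_psum_finset_sum s fun i hi => exists_tendsto_psum_const_mul (a i) (hK i hi))
      (exists_tendsto_psum_finset_sum t hK'),
    fullSum_finset_sum_const_mul s a hK, fullSum_finset_sum t hK']

end FullSum

/-! ## §2 The junction `tsum` ↔ `fullSum` for (1.22)-weighted base-point kernels; the residue-site base-point family -/

section Junction

/-- [folklore] An absolutely second-moment-summable kernel has a summable (1.22) integrand `w ↦ w_κw_λ·f w`. -/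
theorem summable_weight_mul_of_absMoment₂ {f : Pt → ℝ} (hf : AbsMoment₂ f) (κ lam : Fin 4) :
    Summable (fun t : Pt => toReal t κ * toReal t lam * f t) := by
  refine (summable_smul_of_absMoment₂ hf (IsMoment₂.coord2 κ lam)).congr fun t => ?_
  simp only [zsmul_eq_mul, Int.cast_mul, toReal_apply]

/-- [folklore] **THE JUNCTION**: for `AbsMoment₂ f` the punctured full sum of the (1.22) integrand IS the lattice `tsum` — the origin carries
weight `0`: `fullSum (w ↦ w_κw_λ·f w) = Σ' t, t_κ·t_λ·f t`. -/
theorem fullSum_weight_mul_eq_tsum {f : Pt → ℝ} (hf : AbsMoment₂ f) (κ lam : Fin 4) :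
    fullSum (fun t : Pt => toReal t κ * toReal t lam * f t) = ∑' t : Pt, (t κ : ℝ) * (t lam : ℝ) * f t := by
  rw [fullSum_eq_tsum_sub _ (summable_weight_mul_of_absMoment₂ hf κ lam)]
  simp only [toReal_apply, Pi.zero_apply, Int.cast_zero, zero_mul, sub_zero]

/-- [folklore] The (1.22)-weighted base-point kernel has convergent punctured partial sums (the (CONV) slot from `AbsMoment₂`). -/
theorem exists_tendsto_psum_weight_mul {f : Pt → ℝ} (hf : AbsMoment₂ f) (κ lam : Fin 4) :
    ∃ B, Tendsto (psum (fun t : Pt => toReal t κ * toReal t lam * f t)) atTop (𝓝 B) :=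
  exists_tendsto_psum_of_summable _ (summable_weight_mul_of_absMoment₂ hf κ lam)

/-- [folklore] **`avgM2` IN THE END'S CURRENCY**: the base-point average of the fine second moment of a two-point kernel `Q` whose base-point
kernels are absolutely second-moment summable is the uniform average over the residue sites `r ∈ [0,n)⁴` of the punctured FULL SUMS of the
(1.22)-weighted base-point kernels: `avgM2 n Q κ λ = Σ_r n⁻⁴ · fullSum (w ↦ w_κw_λ·baseKer Q (resSite r) w)`. -/
theorem avgM2_eq_sum_fullSum {n : ℕ} (Q : Ker₂ 4) (hQ : ∀ r : Fin 4 → Fin n, AbsMoment₂ (baseKer Q (resSite r))) (κ lam : Fin 4) :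
    avgM2 n Q κ lam =
      ∑ r : Fin 4 → Fin n, ((n : ℝ) ^ 4)⁻¹ * fullSum (fun t : Pt => toReal t κ * toReal t lam * baseKer Q (resSite r) t) := by
  rw [avgM2, mul_sum]
  exact sum_congr rfl fun r _ => by rw [fullSum_weight_mul_eq_tsum (hQ r)]

/-- [folklore] The residue-site map `r ↦ (r_i)_i ∈ ℤ⁴` is injective. -/
theorem resSite_injective (n : ℕ) : Function.Injective (resSite (d := 4) (N := n)) := by
  intro r r' h
  funext i
  have hi := congrFun h i
  simp only [resSite, Nat.cast_inj] at hi
  exact Fin.ext hi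

/-- [folklore] Sums over the image finset of the residue sites are sums over the residue classes. -/
theorem sum_image_resSite {n : ℕ} (f : Pt → ℝ) :
    ∑ b ∈ (univ : Finset (Fin 4 → Fin n)).image resSite, f b = ∑ r : Fin 4 → Fin n, f (resSite r) :=
  sum_image fun _ _ _ _ h => resSite_injective n h

/-- [folklore] There are `n⁴` residue sites. -/
theorem card_image_resSite (n : ℕ) : ((univ : Finset (Fin 4 → Fin n)).image (resSite (d := 4) (N := n))).card = n ^ 4 := by
  rw [card_image_of_injective _ (resSite_injective n), card_univ, Fintype.card_pi, prod_const, Fintype.card_fin, card_univ,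
    Fintype.card_fin]

/-- [folklore] The uniform weights `n⁻⁴` on the residue sites are nonnegative (the END's `hwt0` for this family). -/
theorem uniform_resSite_nonneg (n : ℕ) (b : Pt) (_hb : b ∈ (univ : Finset (Fin 4 → Fin n)).image resSite) :
    (0 : ℝ) ≤ ((n : ℝ) ^ 4)⁻¹ := by positivity

/-- [folklore] The uniform weights `n⁻⁴` on the residue sites sum to `1` for `n ≠ 0` (the END's `hwt1` for this family). -/
theorem sum_uniform_resSite {n : ℕ} (hn : n ≠ 0) :
    ∑ _b ∈ (univ : Finset (Fin 4 → Fin n)).image (resSite (d := 4) (N := n)), ((n : ℝ) ^ 4)⁻¹ = 1 := by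
  rw [sum_const, card_image_resSite, nsmul_eq_mul]
  have h : ((n : ℝ) ^ 4) ≠ 0 := pow_ne_zero 4 (by exact_mod_cast hn)
  push_cast
  exact mul_inv_cancel₀ h

end Junction

/-! ## §3 The slot (F) from the tree's K-R5 currency -/

section SlotF

/-- [folklore] **(F) FOR A PIECE WHOSE SECOND MOMENT IS `n⁻⁸·avgM2`** (the shape of `ReducedKernelSandwichLeg.secondMoment_TOfLeg_eq`,
`ReducedKernelSandwich.secondMoment_TOfRed_eq`, `…secondMoment_TOfGh_eq`): the piece's (1.22)-moment is the uniform base-point average over the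
residue sites of the punctured full sums of the explicit fine integrand `w ↦ n⁻⁸·w_μw_ν·baseKer (Q n) b w`. -/
theorem hF_of_avgM2 {P : ℕ → B12Beta.Kernel 4} {Q : ℕ → Ker₂ 4} {μ ν : Fin 4}
    (hP : ∀ n : ℕ, 2 ≤ n → B12Beta.secondMoment (P n) μ ν = ((n : ℝ) ^ 8)⁻¹ * avgM2 n (Q n) μ ν)
    (hQ : ∀ n : ℕ, 2 ≤ n → ∀ r : Fin 4 → Fin n, AbsMoment₂ (baseKer (Q n) (resSite r))) :
    ∀ n : ℕ, 2 ≤ n → B12Beta.secondMoment (P n) μ ν =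
      ∑ b ∈ (univ : Finset (Fin 4 → Fin n)).image resSite, ((n : ℝ) ^ 4)⁻¹ *
        fullSum (fun w : Pt => ((n : ℝ) ^ 8)⁻¹ * (toReal w μ * toReal w ν * baseKer (Q n) b w)) := by
  intro n hn
  rw [hP n hn, avgM2_eq_sum_fullSum (Q n) (hQ n hn) μ ν, sum_image_resSite, mul_sum]
  refine sum_congr rfl fun r _ => ?_
  rw [fullSum_const_mul _ (exists_tendsto_psum_weight_mul (hQ n hn r) μ ν)]
  ring

/-- [folklore] The (CONV) slot for the integrands of `hF_of_avgM2`. -/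
theorem conv_of_avgM2 {Q : ℕ → Ker₂ 4} {μ ν : Fin 4}
    (hQ : ∀ n : ℕ, 2 ≤ n → ∀ r : Fin 4 → Fin n, AbsMoment₂ (baseKer (Q n) (resSite r))) :
    ∀ n : ℕ, 2 ≤ n → ∀ b ∈ (univ : Finset (Fin 4 → Fin n)).image resSite,
      ∃ B, Tendsto (psum (fun w : Pt => ((n : ℝ) ^ 8)⁻¹ * (toReal w μ * toReal w ν * baseKer (Q n) b w))) atTop (𝓝 B) := by
  intro n hn b hb
  obtain ⟨r, -, rfl⟩ := mem_image.mp hb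
  exact exists_tendsto_psum_const_mul _ (exists_tendsto_psum_weight_mul (hQ n hn r) μ ν)

end SlotF

/-! ## §4 The assembly: T from the slots (K) (U) (F) (SPLIT) (REST) (CONV) -/

section Assembly

variable {κB ι υ T : Type*} [Fintype ι] [Fintype υ] [Fintype T] {μ ν : Fin 4} {N : ℝ}
  {c : ℕ → ℝ} {Bset : ℕ → Finset κB} {wt : ℕ → κB → ℝ} {Gf : ℕ → κB → Pt → ℝ}
  {P : ι → ℕ → B12Beta.Kernel 4} {ω : ι → ℕ → ℝ} {R : υ → ℕ → ℝ} {Kf : ι → ℕ → κB → Pt → ℝ} {Kr : T → ℕ → κB → Pt → ℝ}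

/-- [folklore] **THE DEFECT IDENTITY.**  Under the slots (K) kernel representation, (F) fine representation of every fine-loop piece, (CONV)
convergence of every fine integrand, and (SPLIT) the pointwise term list with the MAIN term `stK μ ν N (Gf n b)` isolated, the road's defect
`c n − Σ_b wt n b · fullSum (stK μ ν N (Gf n b))` IS the unit pieces plus the base-point-averaged full sums of the REST tables — an identity, for
every `n ≥ 2`. -/
theorem defect_eq_of_slots
    (hK : ∀ n : ℕ, 2 ≤ n → c n = (∑ i, ω i n * B12Beta.secondMoment (P i n) μ ν) + ∑ u, R u n)
    (hF : ∀ (i : ι) (n : ℕ), 2 ≤ n → B12Beta.secondMoment (P i n) μ ν = ∑ b ∈ Bset n, wt n b * fullSum (Kf i n b))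
    (hKf : ∀ (i : ι) (n : ℕ), 2 ≤ n → ∀ b ∈ Bset n, ∃ B, Tendsto (psum (Kf i n b)) atTop (𝓝 B))
    (hKr : ∀ (τ : T) (n : ℕ), 2 ≤ n → ∀ b ∈ Bset n, ∃ B, Tendsto (psum (Kr τ n b)) atTop (𝓝 B))
    (hsplit : ∀ n : ℕ, 2 ≤ n → ∀ b ∈ Bset n, ∀ w : Pt,
      (∑ i, ω i n * Kf i n b w) = stK μ ν N (Gf n b) w + ∑ τ, Kr τ n b w) :
    ∀ n : ℕ, 2 ≤ n →
      c n - ∑ b ∈ Bset n, wt n b * fullSum (stK μ ν N (Gf n b))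
        = (∑ u, R u n) + ∑ τ, ∑ b ∈ Bset n, wt n b * fullSum (Kr τ n b) := by
  intro n hn
  -- the MAIN full sum at base point `b` is the weighted fine pieces minus the REST pieces
  have hmain : ∀ b ∈ Bset n, fullSum (stK μ ν N (Gf n b))
      = (∑ i, ω i n * fullSum (Kf i n b)) - ∑ τ, fullSum (Kr τ n b) := by
    intro b hb
    have e : stK μ ν N (Gf n b) = fun w => (∑ i, ω i n * Kf i n b w) - ∑ τ, Kr τ n b w :=
      funext fun w => by rw [hsplit n hn b hb w]; ring
    rw [e]
    exact fullSum_weighted_combination univ univ (fun i => ω i n) (fun i _ => hKf i n hn b hb) (fun τ _ => hKr τ n hn b hb)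
  have hsum : ∑ b ∈ Bset n, wt n b * fullSum (stK μ ν N (Gf n b))
      = (∑ i, ω i n * ∑ b ∈ Bset n, wt n b * fullSum (Kf i n b)) - ∑ τ, ∑ b ∈ Bset n, wt n b * fullSum (Kr τ n b) := by
    calc ∑ b ∈ Bset n, wt n b * fullSum (stK μ ν N (Gf n b))
        = ∑ b ∈ Bset n, ((∑ i, wt n b * (ω i n * fullSum (Kf i n b))) - ∑ τ, wt n b * fullSum (Kr τ n b)) := by
          refine sum_congr rfl fun b hb => ?_
          rw [hmain b hb, mul_sub, mul_sum, mul_sum]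
      _ = (∑ b ∈ Bset n, ∑ i, wt n b * (ω i n * fullSum (Kf i n b))) - ∑ b ∈ Bset n, ∑ τ, wt n b * fullSum (Kr τ n b) :=
          sum_sub_distrib _ _
      _ = (∑ i, ∑ b ∈ Bset n, wt n b * (ω i n * fullSum (Kf i n b))) - ∑ τ, ∑ b ∈ Bset n, wt n b * fullSum (Kr τ n b) := by
          rw [sum_comm, sum_comm (s := Bset n)]
      _ = (∑ i, ω i n * ∑ b ∈ Bset n, wt n b * fullSum (Kf i n b)) - ∑ τ, ∑ b ∈ Bset n, wt n b * fullSum (Kr τ n b) := by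
          congr 1
          refine sum_congr rfl fun i _ => ?_
          rw [mul_sum]
          exact sum_congr rfl fun b _ => by ring
  have hKn : c n = (∑ i, ω i n * ∑ b ∈ Bset n, wt n b * fullSum (Kf i n b)) + ∑ u, R u n := by
    rw [hK n hn]
    congr 1
    exact sum_congr rfl fun i _ => by rw [hF i n hn]
  rw [hsum, hKn]
  ring

variable {CU : υ → ℝ} {CR : T → ℝ}

/-- [folklore] **THE STRONG BOUND FROM THE SLOTS**: adding (U) `|R u n| ≤ CU u` and (REST) `|Σ_b wt n b · fullSum (Kr τ n b)| ≤ CR τ` to the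
slots of `defect_eq_of_slots`, the defect is bounded by `Σ_u CU u + Σ_τ CR τ`, uniformly in `n ≥ 2`. -/
theorem abs_defect_le_of_slots
    (hK : ∀ n : ℕ, 2 ≤ n → c n = (∑ i, ω i n * B12Beta.secondMoment (P i n) μ ν) + ∑ u, R u n)
    (hF : ∀ (i : ι) (n : ℕ), 2 ≤ n → B12Beta.secondMoment (P i n) μ ν = ∑ b ∈ Bset n, wt n b * fullSum (Kf i n b))
    (hKf : ∀ (i : ι) (n : ℕ), 2 ≤ n → ∀ b ∈ Bset n, ∃ B, Tendsto (psum (Kf i n b)) atTop (𝓝 B))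
    (hKr : ∀ (τ : T) (n : ℕ), 2 ≤ n → ∀ b ∈ Bset n, ∃ B, Tendsto (psum (Kr τ n b)) atTop (𝓝 B))
    (hsplit : ∀ n : ℕ, 2 ≤ n → ∀ b ∈ Bset n, ∀ w : Pt,
      (∑ i, ω i n * Kf i n b w) = stK μ ν N (Gf n b) w + ∑ τ, Kr τ n b w)
    (hU : ∀ (u : υ) (n : ℕ), 2 ≤ n → |R u n| ≤ CU u)
    (hR : ∀ (τ : T) (n : ℕ), 2 ≤ n → |∑ b ∈ Bset n, wt n b * fullSum (Kr τ n b)| ≤ CR τ) :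
    ∀ n : ℕ, 2 ≤ n → |c n - ∑ b ∈ Bset n, wt n b * fullSum (stK μ ν N (Gf n b))| ≤ (∑ u, CU u) + ∑ τ, CR τ := by
  intro n hn
  rw [defect_eq_of_slots hK hF hKf hKr hsplit n hn]
  calc |(∑ u, R u n) + ∑ τ, ∑ b ∈ Bset n, wt n b * fullSum (Kr τ n b)|
      ≤ |∑ u, R u n| + |∑ τ, ∑ b ∈ Bset n, wt n b * fullSum (Kr τ n b)| := abs_add_le _ _
    _ ≤ (∑ u, |R u n|) + ∑ τ, |∑ b ∈ Bset n, wt n b * fullSum (Kr τ n b)| :=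
        add_le_add (abs_sum_le_sum_abs _ _) (abs_sum_le_sum_abs _ _)
    _ ≤ (∑ u, CU u) + ∑ τ, CR τ := add_le_add (sum_le_sum fun u _ => hU u n hn) (sum_le_sum fun τ _ => hR τ n hn)

/-- [folklore] **THE ROAD'S TARGET T (STRONG GRADING) FROM ITS SLOTS** — EXACTLY the binder `hT` of `RoadEnd.d1Drift_of_strongRoad` /
`ShellRoadEnd.d1Drift_of_strongRoad_shell` along the blocking scales `n = Lc^m`, `m ≥ 1`, with `U := Σ_u CU u + Σ_τ CR τ`. -/
theorem hT_of_slots {Lc : ℕ} (hLc : 2 ≤ Lc)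
    (hK : ∀ n : ℕ, 2 ≤ n → c n = (∑ i, ω i n * B12Beta.secondMoment (P i n) μ ν) + ∑ u, R u n)
    (hF : ∀ (i : ι) (n : ℕ), 2 ≤ n → B12Beta.secondMoment (P i n) μ ν = ∑ b ∈ Bset n, wt n b * fullSum (Kf i n b))
    (hKf : ∀ (i : ι) (n : ℕ), 2 ≤ n → ∀ b ∈ Bset n, ∃ B, Tendsto (psum (Kf i n b)) atTop (𝓝 B))
    (hKr : ∀ (τ : T) (n : ℕ), 2 ≤ n → ∀ b ∈ Bset n, ∃ B, Tendsto (psum (Kr τ n b)) atTop (𝓝 B))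
    (hsplit : ∀ n : ℕ, 2 ≤ n → ∀ b ∈ Bset n, ∀ w : Pt,
      (∑ i, ω i n * Kf i n b w) = stK μ ν N (Gf n b) w + ∑ τ, Kr τ n b w)
    (hU : ∀ (u : υ) (n : ℕ), 2 ≤ n → |R u n| ≤ CU u)
    (hR : ∀ (τ : T) (n : ℕ), 2 ≤ n → |∑ b ∈ Bset n, wt n b * fullSum (Kr τ n b)| ≤ CR τ) :
    ∀ m : ℕ, 1 ≤ m →
      |c (Lc ^ m) - ∑ b ∈ Bset (Lc ^ m), wt (Lc ^ m) b * fullSum (stK μ ν N (Gf (Lc ^ m) b))| ≤ (∑ u, CU u) + ∑ τ, CR τ :=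
  fun _ hm => abs_defect_le_of_slots hK hF hKf hKr hsplit hU hR _
    (le_trans hLc (by simpa using Nat.pow_le_pow_right (le_trans one_le_two hLc) hm))

/-- [folklore] **THE ROAD'S TARGET T_mean (MEAN GRADING) FROM ITS SLOTS** — EXACTLY the binder `hT` of `RoadEnd.d1Drift_of_meanRoad_table`:
if along `n = Lc^m` the (U) and (REST) bounds grow at most like `g m` with `g m / m → 0` (every «O(1)» of the strong grading may be an
«o(log n)»), then `(c (Lc^m) − Σ_b wt·fullSum (stK μ ν N (Gf (Lc^m) b)))/m → 0`. -/
theorem hT_mean_of_slots {Lc : ℕ} (hLc : 2 ≤ Lc) {g : ℕ → ℝ} (hg : Tendsto (fun m : ℕ => g m / (m : ℝ)) atTop (𝓝 0))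
    (hK : ∀ n : ℕ, 2 ≤ n → c n = (∑ i, ω i n * B12Beta.secondMoment (P i n) μ ν) + ∑ u, R u n)
    (hF : ∀ (i : ι) (n : ℕ), 2 ≤ n → B12Beta.secondMoment (P i n) μ ν = ∑ b ∈ Bset n, wt n b * fullSum (Kf i n b))
    (hKf : ∀ (i : ι) (n : ℕ), 2 ≤ n → ∀ b ∈ Bset n, ∃ B, Tendsto (psum (Kf i n b)) atTop (𝓝 B))
    (hKr : ∀ (τ : T) (n : ℕ), 2 ≤ n → ∀ b ∈ Bset n, ∃ B, Tendsto (psum (Kr τ n b)) atTop (𝓝 B))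
    (hsplit : ∀ n : ℕ, 2 ≤ n → ∀ b ∈ Bset n, ∀ w : Pt,
      (∑ i, ω i n * Kf i n b w) = stK μ ν N (Gf n b) w + ∑ τ, Kr τ n b w)
    (hU : ∀ (u : υ) (m : ℕ), 1 ≤ m → |R u (Lc ^ m)| ≤ CU u * g m)
    (hR : ∀ (τ : T) (m : ℕ), 1 ≤ m → |∑ b ∈ Bset (Lc ^ m), wt (Lc ^ m) b * fullSum (Kr τ (Lc ^ m) b)| ≤ CR τ * g m) :
    Tendsto (fun m : ℕ => (c (Lc ^ m) - ∑ b ∈ Bset (Lc ^ m), wt (Lc ^ m) b * fullSum (stK μ ν N (Gf (Lc ^ m) b))) / (m : ℝ))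
      atTop (𝓝 0) := by
  set S : ℝ := (∑ u, CU u) + ∑ τ, CR τ with hS
  have hbd : ∀ m : ℕ, 1 ≤ m →
      |c (Lc ^ m) - ∑ b ∈ Bset (Lc ^ m), wt (Lc ^ m) b * fullSum (stK μ ν N (Gf (Lc ^ m) b))| ≤ S * g m := by
    intro m hm
    rw [defect_eq_of_slots hK hF hKf hKr hsplit _
      (le_trans hLc (by simpa using Nat.pow_le_pow_right (le_trans one_le_two hLc) hm))]
    calc |(∑ u, R u (Lc ^ m)) + ∑ τ, ∑ b ∈ Bset (Lc ^ m), wt (Lc ^ m) b * fullSum (Kr τ (Lc ^ m) b)|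
        ≤ (∑ u, |R u (Lc ^ m)|) + ∑ τ, |∑ b ∈ Bset (Lc ^ m), wt (Lc ^ m) b * fullSum (Kr τ (Lc ^ m) b)| :=
          (abs_add_le _ _).trans (add_le_add (abs_sum_le_sum_abs _ _) (abs_sum_le_sum_abs _ _))
      _ ≤ (∑ u, CU u * g m) + ∑ τ, CR τ * g m := add_le_add (sum_le_sum fun u _ => hU u m hm) (sum_le_sum fun τ _ => hR τ m hm)
      _ = S * g m := by rw [hS, ← sum_mul, ← sum_mul, add_mul]
  refine squeeze_zero_norm' (a := fun m => S * (g m / (m : ℝ))) ?_ ?_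
  · filter_upwards [eventually_ge_atTop 1] with m hm
    have hmpos : (0 : ℝ) < m := by exact_mod_cast hm
    rw [Real.norm_eq_abs, abs_div, abs_of_pos hmpos, ← mul_div_assoc]
    exact div_le_div_of_nonneg_right (hbd m hm) hmpos.le
  · have h := hg.const_mul S
    rw [mul_zero] at h
    exact h

end Assembly

end Summit.QuantumFields.BalabanUV.Beta.D1BFx.Assembly
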